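import Summits.CriticalPhenomena.PercolationContinuityZ3.Theorems.Transplant.FKThreeApexT3Envelope
import HarnessLib

/-!
# The three-apex monoid: the double-envelope reduction of type T3 — the monotone reduction and the theorem

Helper file (`--supports stmt-CriticalPhenomena-4575`), FK sub-lane `prim-bschramm-fk-3` (gen 16); builds on p205010 (kernel theorem, internal audit
signed; external expert review pending).  No sorries; standard axioms.  Memo `bschramm/prim-bschramm-fk-3/T3-ENVELOPE.md` §2.

Continues `…T3Envelope` (the master identity `λλ'μμ'·t3Form = q²(1−q)·envForm(k, k'; R₂)`).  Here:
* the environment forms are non-negative on the monoid (`InK.nAB_nonneg`, `InK.products_nonneg`, …);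
* the four SLOPES of the bilinear form are non-negative for admissible partners (`InK.slope1_nonneg` — an explicit sum of products of non-negative
  linear forms; `InK.slope2_nonneg` — the U-inequality at apex `b`, `InK.phiB_nonneg`; primed versions at apex `a`, `InK.uCond`);
* hence `envForm` is minimised on the FRONTIER `(A₁−m)(A₂−m) = m²`, where it is a positive multiple of `vForm q θ θ'`
  (`InK.envForm_nonneg_of_envelopeA`);
* the leaf coefficient triples are admissible (`adm_leaf`), so **`InK.t3Form_nonneg_of_envelopeA`: `EnvelopeA q` implies type T3** for all
  leaf probabilities in `[0,1]`, all `R ∈ InK q`, `0 < q ≤ 1` (degenerate leaves `b₁ = c₁ = 1` / `a₂ = c₂ = 1` directly). [folklore]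
-/

noncomputable section

namespace Summit.CriticalPhenomena.PercolationContinuityZ3.Theorems

namespace FK

namespace ThreeApex

/-! ### Signs of the environment forms on the monoid -/

/-- Hat-coordinate bounds on the monoid: `0 ≤ u ≤ x, y, z` and `x, y, z ≤ v`, `0 ≤ Z₁`. [folklore] -/
theorem InK.hat_bounds {q : ℝ} (hq0 : 0 ≤ q) {Z : V5} (h : InK q Z) :
    0 ≤ Z.z0 ∧ Z.z0 ≤ hx Z ∧ Z.z0 ≤ hy Z ∧ Z.z0 ≤ hz Z ∧ hx Z ≤ Z.total ∧ hy Z ≤ Z.total ∧ hz Z ≤ Z.total ∧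
      hx Z + hy Z + hz Z ≤ Z.total + 2 * Z.z0 := by
  have hN := h.nonneg hq0
  obtain ⟨h0, hab, hac, hbc, h1⟩ := hN
  simp only [hx, hy, hz, V5.total]
  refine ⟨h0, ?_, ?_, ?_, ?_, ?_, ?_, ?_⟩ <;> linarith

/-- `N^{ab} ≥ 0` on the monoid (Theorem M). [folklore] -/
theorem InK.nAB_nonneg {q : ℝ} (hq0 : 0 ≤ q) (hq1 : q ≤ 1) {Z : V5} (h : InK q Z) : 0 ≤ nAB q Z := by
  rw [nAB_eq]; exact h.swapBC.masterN_nonneg hq0 hq1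
/-- `N^{ac} ≥ 0` on the monoid (Theorem M). [folklore] -/
theorem InK.nAC_nonneg {q : ℝ} (hq0 : 0 ≤ q) (hq1 : q ≤ 1) {Z : V5} (h : InK q Z) : 0 ≤ nAC q Z := by
  rw [nAC_eq]; exact h.masterN_nonneg hq0 hq1
/-- `N^{bc} ≥ 0` on the monoid (Theorem M). [folklore] -/
theorem InK.nBC_nonneg {q : ℝ} (hq0 : 0 ≤ q) (hq1 : q ≤ 1) {Z : V5} (h : InK q Z) : 0 ≤ nBC q Z := by
  rw [nBC_eq]; exact h.swapAB.masterN_nonneg hq0 hq1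

/-- `E_aa, E_bb, E_cc, P_ab, P_ac, P_bc, P₁, M_c ≥ 0` on the monoid (products of non-negative linear forms). [folklore] -/
theorem InK.products_nonneg {q : ℝ} (hq0 : 0 ≤ q) {Z : V5} (h : InK q Z) :
    0 ≤ eAA q Z ∧ 0 ≤ eBB q Z ∧ 0 ≤ eCC q Z ∧ 0 ≤ pAB q Z ∧ 0 ≤ pAC q Z ∧ 0 ≤ pBC q Z ∧ 0 ≤ pTop q Z ∧ 0 ≤ massC q Z := by
  obtain ⟨h0, hxu, hyu, hzu, hxv, hyv, hzv, -⟩ := h.hat_bounds hq0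
  have hx0 : 0 ≤ hx Z := le_trans h0 hxu
  have hy0 : 0 ≤ hy Z := le_trans h0 hyu
  have hz0 : 0 ≤ hz Z := le_trans h0 hzu
  have e1 : 0 ≤ Z.total - (1 - q) * hx Z := by nlinarith
  have e2 : 0 ≤ Z.total - (1 - q) * hy Z := by nlinarith
  have e3 : 0 ≤ Z.total - (1 - q) * hz Z := by nlinarith
  have f1 : 0 ≤ hy Z + hz Z - (2 - q) * Z.z0 := by nlinarith
  have f2 : 0 ≤ hx Z + hz Z - (2 - q) * Z.z0 := by nlinarith
  have f3 : 0 ≤ hx Z + hy Z - (2 - q) * Z.z0 := by nlinarith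
  have f4 : 0 ≤ hx Z + hy Z + hz Z - (2 - q) * Z.z0 := by nlinarith
  have hv : 0 ≤ Z.total := le_trans hx0 hxv
  refine ⟨mul_nonneg e1 f1, mul_nonneg e2 f2, mul_nonneg e3 f3, mul_nonneg hv f1, mul_nonneg hv f2, mul_nonneg hv f3, mul_nonneg hv f4,
    mul_nonneg f1 (by linarith)⟩

/-! ### Admissible coefficient vectors and the monotone reduction -/

/-- The first slope `∂envForm/∂A₁ = A₁'E_aa − m'N^{bc} + A₂'N^{ac} + q m' P_ab` is non-negative for `0 ≤ m' ≤ A₁', A₂'`: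
it equals `(A₁'−m')E_aa + (A₂'−m')N^{ac} + m'·B₁` with `B₁ = E_aa + N^{ac} + qP_ab − N^{bc} =
2q² xu + 3q x(y−u) + (q+q²) u(v−x) + (2+q)(v−x)(y−u) + q x(z−u) + q (v−x)(z−u) ≥ 0`. [folklore] -/
theorem InK.slope1_nonneg {q : ℝ} (hq0 : 0 ≤ q) (hq1 : q ≤ 1) {Z : V5} (h : InK q Z) {A₁' A₂' m' : ℝ}
    (hm : 0 ≤ m') (h1 : m' ≤ A₁') (h2 : m' ≤ A₂') :
    0 ≤ A₁' * eAA q Z - m' * nBC q Z + A₂' * nAC q Z + q * m' * pAB q Z := by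
  obtain ⟨h0, hxu, hyu, hzu, hxv, -, -, -⟩ := h.hat_bounds hq0
  obtain ⟨hE, -, -, -, -, -, -, -⟩ := h.products_nonneg hq0
  have hN := h.nAC_nonneg hq0 hq1
  have hB : eAA q Z + nAC q Z + q * pAB q Z - nBC q Z =
      2 * q ^ 2 * (hx Z * Z.z0) + 3 * q * (hx Z * (hy Z - Z.z0)) + (q + q ^ 2) * (Z.z0 * (Z.total - hx Z))
      + (2 + q) * ((Z.total - hx Z) * (hy Z - Z.z0)) + q * (hx Z * (hz Z - Z.z0)) + q * ((Z.total - hx Z) * (hz Z - Z.z0)) := by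
    simp only [eAA, nAC, pAB, nBC]; ring
  have hB0 : 0 ≤ eAA q Z + nAC q Z + q * pAB q Z - nBC q Z := by
    rw [hB]
    have hx0 : 0 ≤ hx Z := le_trans h0 hxu
    have : 0 ≤ Z.total - hx Z := by linarith
    have : 0 ≤ hy Z - Z.z0 := by linarith
    have : 0 ≤ hz Z - Z.z0 := by linarith
    positivity
  have key : A₁' * eAA q Z - m' * nBC q Z + A₂' * nAC q Z + q * m' * pAB q Z =
      (A₁' - m') * eAA q Z + (A₂' - m') * nAC q Z + m' * (eAA q Z + nAC q Z + q * pAB q Z - nBC q Z) := by ring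
  rw [key]
  have : 0 ≤ A₁' - m' := by linarith
  have : 0 ≤ A₂' - m' := by linarith
  positivity

/-- The mirror slope `∂envForm/∂A₁' = A₁E_aa + A₂N^{bc} − mN^{ac} + q m P_ab ≥ 0` for `0 ≤ m ≤ A₁, A₂`. [folklore] -/
theorem InK.slope1'_nonneg {q : ℝ} (hq0 : 0 ≤ q) (hq1 : q ≤ 1) {Z : V5} (h : InK q Z) {A₁ A₂ m : ℝ}
    (hm : 0 ≤ m) (h1 : m ≤ A₁) (h2 : m ≤ A₂) :
    0 ≤ A₁ * eAA q Z + A₂ * nBC q Z - m * nAC q Z + q * m * pAB q Z := by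
  obtain ⟨h0, hxu, hyu, hzu, hxv, -, -, -⟩ := h.hat_bounds hq0
  obtain ⟨hE, -, -, -, -, -, -, -⟩ := h.products_nonneg hq0
  have hN := h.nBC_nonneg hq0 hq1
  have hB : eAA q Z + nBC q Z + q * pAB q Z - nAC q Z =
      2 * q ^ 2 * (hx Z * Z.z0) + 3 * q * (hx Z * (hz Z - Z.z0)) + (q + q ^ 2) * (Z.z0 * (Z.total - hx Z))
      + (2 + q) * ((Z.total - hx Z) * (hz Z - Z.z0)) + q * (hx Z * (hy Z - Z.z0)) + q * ((Z.total - hx Z) * (hy Z - Z.z0)) := by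
    simp only [eAA, nBC, pAB, nAC]; ring
  have hB0 : 0 ≤ eAA q Z + nBC q Z + q * pAB q Z - nAC q Z := by
    rw [hB]
    have hx0 : 0 ≤ hx Z := le_trans h0 hxu
    have : 0 ≤ Z.total - hx Z := by linarith
    have : 0 ≤ hy Z - Z.z0 := by linarith
    have : 0 ≤ hz Z - Z.z0 := by linarith
    positivity
  have key : A₁ * eAA q Z + A₂ * nBC q Z - m * nAC q Z + q * m * pAB q Z =
      (A₁ - m) * eAA q Z + (A₂ - m) * nBC q Z + m * (eAA q Z + nBC q Z + q * pAB q Z - nAC q Z) := by ring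
  rw [key]
  have : 0 ≤ A₁ - m := by linarith
  have : 0 ≤ A₂ - m := by linarith
  positivity

/-- The second slope `∂envForm/∂A₂ = A₁'N^{bc} − m'E_bb + A₂'N^{ab} + q m' P_ac ≥ 0` for ADMISSIBLE `(A₁', A₂', m')` — this is the
U-inequality at apex `b` (`InK.phiB_nonneg` with weights `(A₂', A₁')`): `E_bb − qP_ac = (1−q)M_b`. [folklore] -/
theorem InK.slope2_nonneg {q : ℝ} (hq0 : 0 < q) (hq1 : q ≤ 1) {Z : V5} (h : InK q Z) {A₁' A₂' m' : ℝ}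
    (ha : Adm A₁' A₂' m') :
    0 ≤ A₁' * nBC q Z - m' * eBB q Z + A₂' * nAB q Z + q * m' * pAC q Z := by
  obtain ⟨hm, h1, h2, hprod⟩ := ha
  have hMb : 0 ≤ massB q Z := by
    rw [massB_hat]
    obtain ⟨h0, hxu, hyu, hzu, -, hyv, -, -⟩ := h.hat_bounds hq0.le
    have : 0 ≤ hx Z + hz Z - (2 - q) * Z.z0 := by nlinarith
    exact mul_nonneg this (by linarith)
  have hNab := h.nAB_nonneg hq0.le hq1
  have hNbc := h.nBC_nonneg hq0.le hq1
  have hrel : eBB q Z - q * pAC q Z = (1 - q) * massB q Z := by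
    rw [massB_hat]; simp only [eBB, pAC]; ring
  -- the U-inequality at b with weights (A₂', A₁')
  have hU := h.phiB_nonneg hq0 hq1 (le_trans hm h2) (le_trans hm h1)
  have hUeq : phiB q A₂' A₁' Z = (A₁' + A₂') * (A₂' * nAB q Z + A₁' * nBC q Z) - A₁' * A₂' * massB q Z := by
    simp only [phiB, nAB_eq, nBC_eq]; ring
  rw [hUeq] at hU
  -- A₁'A₂' ≥ m'(A₁'+A₂')
  have hAA : m' * (A₁' + A₂') ≤ A₁' * A₂' := by nlinarith
  have goal_eq : A₁' * nBC q Z - m' * eBB q Z + A₂' * nAB q Z + q * m' * pAC q Z =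
      (A₂' * nAB q Z + A₁' * nBC q Z) - m' * ((1 - q) * massB q Z) := by rw [← hrel]; ring
  rw [goal_eq]
  by_cases hs : A₁' + A₂' = 0
  · have ha1 : A₁' = 0 := by linarith
    have ha2 : A₂' = 0 := by linarith
    have hm0 : m' = 0 := by linarith
    simp [ha1, ha2, hm0]
  · have hs' : 0 < A₁' + A₂' := lt_of_le_of_ne (by linarith) (Ne.symm hs)
    -- (A₁'+A₂') X ≥ A₁'A₂' M_b ≥ m'(A₁'+A₂') M_b
    have h3 : (A₁' + A₂') * (A₂' * nAB q Z + A₁' * nBC q Z) ≥ (A₁' + A₂') * (m' * massB q Z) := by nlinarith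
    have h4 : A₂' * nAB q Z + A₁' * nBC q Z ≥ m' * massB q Z := le_of_mul_le_mul_left h3 hs'
    have h5 : m' * ((1 - q) * massB q Z) ≤ m' * massB q Z := by
      have : (1 - q) * massB q Z ≤ massB q Z := by nlinarith
      exact mul_le_mul_of_nonneg_left this hm
    linarith

/-- The mirror second slope `∂envForm/∂A₂' = A₁N^{ac} + A₂N^{ab} − mE_cc + q m P_bc ≥ 0` for admissible `(A₁, A₂, m)` — the U-inequality at
apex `a` (`InK.uCond` with weights `(A₂, A₁)`): `E_cc − qP_bc = (1−q)M_a`. [folklore] -/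
theorem InK.slope2'_nonneg {q : ℝ} (hq0 : 0 < q) (hq1 : q ≤ 1) {Z : V5} (h : InK q Z) {A₁ A₂ m : ℝ} (ha : Adm A₁ A₂ m) :
    0 ≤ A₁ * nAC q Z + A₂ * nAB q Z - m * eCC q Z + q * m * pBC q Z := by
  obtain ⟨hm, h1, h2, hprod⟩ := ha
  have hMa : 0 ≤ massA q Z := by
    rw [massA_hat]
    obtain ⟨h0, hxu, hyu, hzu, -, -, hzv, -⟩ := h.hat_bounds hq0.le
    have : 0 ≤ hx Z + hy Z - (2 - q) * Z.z0 := by nlinarith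
    exact mul_nonneg this (by linarith)
  have hNab := h.nAB_nonneg hq0.le hq1
  have hNac := h.nAC_nonneg hq0.le hq1
  have hrel : eCC q Z - q * pBC q Z = (1 - q) * massA q Z := by
    rw [massA_hat]; simp only [eCC, pBC]; ring
  have hU := h.uCond hq0 hq1 A₂ A₁ (le_trans hm h2) (le_trans hm h1)
  have hUeq : uForm q A₂ A₁ Z = (A₁ + A₂) * (A₂ * nAB q Z + A₁ * nAC q Z) - A₁ * A₂ * massA q Z := by
    simp only [uForm, nAB_eq, nAC_eq]; ring
  rw [hUeq] at hU
  have hAA : m * (A₁ + A₂) ≤ A₁ * A₂ := by nlinarith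
  have goal_eq : A₁ * nAC q Z + A₂ * nAB q Z - m * eCC q Z + q * m * pBC q Z =
      (A₂ * nAB q Z + A₁ * nAC q Z) - m * ((1 - q) * massA q Z) := by rw [← hrel]; ring
  rw [goal_eq]
  by_cases hs : A₁ + A₂ = 0
  · have ha1 : A₁ = 0 := by linarith
    have ha2 : A₂ = 0 := by linarith
    have hm0 : m = 0 := by linarith
    simp [ha1, ha2, hm0]
  · have hs' : 0 < A₁ + A₂ := lt_of_le_of_ne (by linarith) (Ne.symm hs)
    have h3 : (A₁ + A₂) * (A₂ * nAB q Z + A₁ * nAC q Z) ≥ (A₁ + A₂) * (m * massA q Z) := by nlinarith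
    have h4 : A₂ * nAB q Z + A₁ * nAC q Z ≥ m * massA q Z := le_of_mul_le_mul_left h3 hs'
    have h5 : m * ((1 - q) * massA q Z) ≤ m * massA q Z := by
      have : (1 - q) * massA q Z ≤ massA q Z := by nlinarith
      exact mul_le_mul_of_nonneg_left this hm
    linarith

/-- `envForm` is affine in `A₂` with slope `slope2`, affine in `A₂'` with slope `slope2'`, and bihomogeneous. [folklore] -/
theorem envForm_split (q A₁ A₂ A₂0 m A₁' A₂' A₂0' m' : ℝ) (Z : V5) :
    envForm q A₁ A₂ m A₁' A₂' m' Z = envForm q A₁ A₂0 m A₁' A₂0' m' Z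
      + (A₂ - A₂0) * (A₁' * nBC q Z - m' * eBB q Z + A₂' * nAB q Z + q * m' * pAC q Z)
      + (A₂' - A₂0') * (A₁ * nAC q Z + A₂0 * nAB q Z - m * eCC q Z + q * m * pBC q Z) := by
  simp only [envForm]; ring

/-- Bihomogeneity: `envForm (c k) (c' k') = c c' envForm k k'`. [folklore] -/
theorem envForm_smul (q c c' A₁ A₂ m A₁' A₂' m' : ℝ) (Z : V5) :
    envForm q (c * A₁) (c * A₂) (c * m) (c' * A₁') (c' * A₂') (c' * m') Z = c * c' * envForm q A₁ A₂ m A₁' A₂' m' Z := by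
  simp only [envForm]; ring

/-- With `m = 0` the form is the combination `A₁·slope1 + A₂·slope2` of the two slopes. [folklore] -/
theorem envForm_m_zero (q A₁ A₂ A₁' A₂' m' : ℝ) (Z : V5) :
    envForm q A₁ A₂ 0 A₁' A₂' m' Z = A₁ * (A₁' * eAA q Z - m' * nBC q Z + A₂' * nAC q Z + q * m' * pAB q Z)
      + A₂ * (A₁' * nBC q Z - m' * eBB q Z + A₂' * nAB q Z + q * m' * pAC q Z) := by
  simp only [envForm]; ring

/-- With `m' = 0` the form is `A₁'·slope1' + A₂'·slope2'`. [folklore] -/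
theorem envForm_m'_zero (q A₁ A₂ m A₁' A₂' : ℝ) (Z : V5) :
    envForm q A₁ A₂ m A₁' A₂' 0 Z = A₁' * (A₁ * eAA q Z + A₂ * nBC q Z - m * nAC q Z + q * m * pAB q Z)
      + A₂' * (A₁ * nAC q Z + A₂ * nAB q Z - m * eCC q Z + q * m * pBC q Z) := by
  simp only [envForm]; ring

/-- **The monotone reduction.**  `EnvelopeA q` (non-negativity on the frontier) implies `envForm ≥ 0` for ALL admissible pairs of coefficient
triples, on the whole monoid. [folklore] -/
theorem InK.envForm_nonneg_of_envelopeA {q : ℝ} (hq0 : 0 < q) (hq1 : q ≤ 1) (hA : EnvelopeA q) {Z : V5} (h : InK q Z)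
    {A₁ A₂ m A₁' A₂' m' : ℝ} (ha : Adm A₁ A₂ m) (ha' : Adm A₁' A₂' m') :
    0 ≤ envForm q A₁ A₂ m A₁' A₂' m' Z := by
  -- Step 0: the degenerate cases m = 0 / m' = 0
  rcases eq_or_lt_of_le ha.hm with hm0 | hmpos
  · rw [← hm0, envForm_m_zero]
    have s1 := h.slope1_nonneg hq0.le hq1 ha'.hm ha'.h1 ha'.h2
    have s2 := h.slope2_nonneg hq0 hq1 ha'
    have : 0 ≤ A₁ := by linarith [ha.h1, ha.hm]
    have : 0 ≤ A₂ := by linarith [ha.h2, ha.hm]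
    positivity
  rcases eq_or_lt_of_le ha'.hm with hm0' | hmpos'
  · rw [← hm0', envForm_m'_zero]
    have s1 := h.slope1'_nonneg hq0.le hq1 ha.hm ha.h1 ha.h2
    have s2 := h.slope2'_nonneg hq0 hq1 ha
    have : 0 ≤ A₁' := by linarith [ha'.h1, ha'.hm]
    have : 0 ≤ A₂' := by linarith [ha'.h2, ha'.hm]
    positivity
  -- Step 1: both m, m' > 0; frontier points below (A₁, A₂) and (A₁', A₂')
  have hA1 : m < A₁ := by
    by_contra hc
    have : A₁ - m ≤ 0 := by linarith
    have h2 : 0 ≤ A₂ - m := by linarith [ha.h2]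
    have : (A₁ - m) * (A₂ - m) ≤ 0 := mul_nonpos_of_nonpos_of_nonneg this h2
    nlinarith [ha.hprod]
  have hA1' : m' < A₁' := by
    by_contra hc
    have : A₁' - m' ≤ 0 := by linarith
    have h2 : 0 ≤ A₂' - m' := by linarith [ha'.h2]
    have : (A₁' - m') * (A₂' - m') ≤ 0 := mul_nonpos_of_nonpos_of_nonneg this h2
    nlinarith [ha'.hprod]
  set θ := (A₁ - m) / m with hθ
  set θ' := (A₁' - m') / m' with hθ'
  have hθ0 : 0 < θ := div_pos (by linarith) hmpos
  have hθ0' : 0 < θ' := div_pos (by linarith) hmpos'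
  -- frontier second coordinates
  set A₂0 := m + m ^ 2 / (A₁ - m) with hA₂0
  set A₂0' := m' + m' ^ 2 / (A₁' - m') with hA₂0'
  have hle : A₂0 ≤ A₂ := by
    have hd : 0 < A₁ - m := by linarith
    have : m ^ 2 / (A₁ - m) ≤ A₂ - m := by rw [div_le_iff₀ hd]; nlinarith [ha.hprod]
    linarith
  have hle' : A₂0' ≤ A₂' := by
    have hd : 0 < A₁' - m' := by linarith
    have : m' ^ 2 / (A₁' - m') ≤ A₂' - m' := by rw [div_le_iff₀ hd]; nlinarith [ha'.hprod]
    linarith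
  -- the frontier point is (m/θ)·(θ(1+θ), 1+θ, θ)
  have hmθ : 0 < m / θ := div_pos hmpos hθ0
  have hmθ' : 0 < m' / θ' := div_pos hmpos' hθ0'
  have hmne : m ≠ 0 := hmpos.ne'
  have hmne' : m' ≠ 0 := hmpos'.ne'
  have hdne : A₁ - m ≠ 0 := by linarith
  have hdne' : A₁' - m' ≠ 0 := by linarith
  have f1 : A₁ = m / θ * (θ * (1 + θ)) := by
    rw [hθ]; field_simp; ring
  have f2 : A₂0 = m / θ * (1 + θ) := by
    rw [hA₂0, hθ]; field_simp; ring
  have f3 : m = m / θ * θ := by field_simp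
  have f1' : A₁' = m' / θ' * (θ' * (1 + θ')) := by
    rw [hθ']; field_simp; ring
  have f2' : A₂0' = m' / θ' * (1 + θ') := by
    rw [hA₂0', hθ']; field_simp; ring
  have f3' : m' = m' / θ' * θ' := by field_simp
  -- frontier value
  have hfront : 0 ≤ envForm q A₁ A₂0 m A₁' A₂0' m' Z := by
    rw [f1, f2, f1', f2']
    conv_lhs => rw [show (0 : ℝ) = 0 from rfl]
    have e := envForm_smul q (m / θ) (m' / θ') (θ * (1 + θ)) (1 + θ) θ (θ' * (1 + θ')) (1 + θ') θ' Z
    rw [← f3, ← f3'] at e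
    rw [e]
    exact mul_nonneg (mul_nonneg hmθ.le hmθ'.le) (hA θ θ' hθ0.le hθ0'.le Z h)
  -- frontier triples are admissible (for the slopes)
  have hadm0 : Adm A₁ A₂0 m := by
    refine ⟨ha.hm, ha.h1, by rw [hA₂0]; have := div_nonneg (sq_nonneg m) (by linarith : (0:ℝ) ≤ A₁ - m); linarith, ?_⟩
    rw [hA₂0]
    have hd : 0 < A₁ - m := by linarith
    have : (A₁ - m) * (m + m ^ 2 / (A₁ - m) - m) = m ^ 2 := by field_simp; ring
    rw [this]
  have hadm0' : Adm A₁' A₂0' m' := by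
    refine ⟨ha'.hm, ha'.h1, by rw [hA₂0']; have := div_nonneg (sq_nonneg m') (by linarith : (0:ℝ) ≤ A₁' - m'); linarith, ?_⟩
    rw [hA₂0']
    have hd : 0 < A₁' - m' := by linarith
    have : (A₁' - m') * (m' + m' ^ 2 / (A₁' - m') - m') = m' ^ 2 := by field_simp; ring
    rw [this]
  rw [envForm_split q A₁ A₂ A₂0 m A₁' A₂' A₂0' m' Z]
  have s2 := h.slope2_nonneg hq0 hq1 ha'
  have s2' := h.slope2'_nonneg hq0 hq1 hadm0
  have : 0 ≤ A₂ - A₂0 := by linarith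
  have : 0 ≤ A₂' - A₂0' := by linarith
  have t1 : 0 ≤ (A₂ - A₂0) * (A₁' * nBC q Z - m' * eBB q Z + A₂' * nAB q Z + q * m' * pAC q Z) := mul_nonneg ‹0 ≤ A₂ - A₂0› s2
  have t2 : 0 ≤ (A₂' - A₂0') * (A₁ * nAC q Z + A₂0 * nAB q Z - m * eCC q Z + q * m * pBC q Z) := mul_nonneg ‹0 ≤ A₂' - A₂0'› s2'
  linarith

/-! ### The leaf coefficients are admissible; the reduction theorem -/

/-- **The double-envelope reduction of type T3.**  If the two-parameter frontier form is non-negative on the monoid (`EnvelopeA q`), then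
the T3 Rayleigh form is non-negative for ALL leaf probabilities `b₁, c₁, a₂, c₂ ∈ [0,1]` and every `R` in the monoid (`0 < q ≤ 1`). [folklore] -/
theorem InK.t3Form_nonneg_of_envelopeA {q : ℝ} (hq0 : 0 < q) (hq1 : q ≤ 1) (hA : EnvelopeA q) {b₁ c₁ a₂ c₂ : ℝ}
    (hb0 : 0 ≤ b₁) (hb1 : b₁ ≤ 1) (hc0 : 0 ≤ c₁) (hc1 : c₁ ≤ 1) (ha0 : 0 ≤ a₂) (ha1 : a₂ ≤ 1) (hd0 : 0 ≤ c₂) (hd1 : c₂ ≤ 1)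
    {R : V5} (hR : InK q R) : 0 ≤ t3Form q b₁ c₁ a₂ c₂ R := by
  -- degenerate leaves: a single surviving non-negative term
  by_cases hdeg1 : b₁ = 1 ∧ c₁ = 1
  · obtain ⟨rfl, rfl⟩ := hdeg1
    obtain ⟨h0, -, -, hzu, -, -, hzv, -⟩ := hR.hat_bounds hq0.le
    have e : t3Form q 1 1 a₂ c₂ R = q ^ 2 * (1 - q) * (a₂ * (1 - c₂) * (q * (1 - a₂) + a₂)) * (hz R * R.total) := by
      simp only [t3Form]; ring
    rw [e]
    have : 0 ≤ 1 - q := by linarith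
    have : 0 ≤ 1 - c₂ := by linarith
    have : 0 ≤ 1 - a₂ := by linarith
    have : 0 ≤ hz R := le_trans h0 hzu
    have : 0 ≤ R.total := le_trans this hzv
    positivity
  by_cases hdeg2 : a₂ = 1 ∧ c₂ = 1
  · obtain ⟨rfl, rfl⟩ := hdeg2
    obtain ⟨h0, -, hyu, -, -, hyv, -, -⟩ := hR.hat_bounds hq0.le
    have e : t3Form q b₁ c₁ 1 1 R = q ^ 2 * (1 - q) * (b₁ * (1 - c₁) * (q * (1 - b₁) + b₁)) * (hy R * R.total) := by
      simp only [t3Form]; ring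
    rw [e]
    have : 0 ≤ 1 - q := by linarith
    have : 0 ≤ 1 - c₁ := by linarith
    have : 0 ≤ 1 - b₁ := by linarith
    have : 0 ≤ hy R := le_trans h0 hyu
    have : 0 ≤ R.total := le_trans this hyv
    positivity
  -- generic case: divide the master identity by λλ'μμ' > 0
  have hL : 0 < lamOf q b₁ c₁ * lamPOf q b₁ c₁ := mul_pos (lamOf_pos hq0 hb0 hb1 hc0 hc1 hdeg1) (lamPOf_pos hq0 hq1 hb0 hb1 hc0 hc1)
  have hM : 0 < lamOf q a₂ c₂ * lamPOf q a₂ c₂ := mul_pos (lamOf_pos hq0 ha0 ha1 hd0 hd1 hdeg2) (lamPOf_pos hq0 hq1 ha0 ha1 hd0 hd1)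
  have hid := t3_master_identity q b₁ c₁ a₂ c₂ R
  have hR₂ : InK q (conv (leaf q 0 b₁ c₁) (conv (leaf q a₂ 0 c₂) R)) :=
    InK.step (IsLetter.leaf le_rfl zero_le_one hb0 hb1 hc0 hc1) (InK.step (IsLetter.leaf ha0 ha1 le_rfl zero_le_one hd0 hd1) hR)
  have henv := hR₂.envForm_nonneg_of_envelopeA hq0 hq1 hA (adm_leaf hq0.le hb0 hb1 hc0 hc1) (adm_leaf hq0.le ha0 ha1 hd0 hd1)
  have hrhs : 0 ≤ q ^ 2 * (1 - q) * envForm q (b₁ * (1 - c₁) * lamPOf q b₁ c₁) (c₁ * (1 - b₁) * lamPOf q b₁ c₁) (b₁ * c₁ * (1 - b₁) * (1 - c₁))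
      (a₂ * (1 - c₂) * lamPOf q a₂ c₂) (c₂ * (1 - a₂) * lamPOf q a₂ c₂) (a₂ * c₂ * (1 - a₂) * (1 - c₂))
      (conv (leaf q 0 b₁ c₁) (conv (leaf q a₂ 0 c₂) R)) := by
    have : 0 ≤ 1 - q := by linarith
    positivity
  rw [← hid] at hrhs
  have hLM : 0 < lamOf q b₁ c₁ * lamPOf q b₁ c₁ * (lamOf q a₂ c₂ * lamPOf q a₂ c₂) := mul_pos hL hM
  exact (mul_nonneg_iff_of_pos_left hLM).mp hrhs

end ThreeApex

end FK

end Summit.CriticalPhenomena.PercolationContinuityZ3.Theorems
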